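import Summits.QuantumFields.BalabanUV.Beta.EriceRemainderEnclosureHistoryAutonomyComparisonAgeCompositionOneLagDecayFlow
import Summits.QuantumFields.BalabanUV.Beta.EriceRemainderEnclosureHistoryAutonomyComparisonAgeCompositionYoungestTailSumCertificate

/-!
# EriceRemainderEnclosureHistoryAutonomyComparisonAgeCompositionYoungestTailSumFlow — (E82b) route (N), first order: THE YOUNGEST MEMBER OF THE STATIC
# FAMILY (S-b) HOLDS ALONG EVERY TWO-AGE FLOW — for every box solution of an isotone memory with floor dominated by a profile with the ages `1` and `k`,
# every damping in the relaxed class: `(1 + KL 1 m 0)·Hg 1 (m+1)·KL 1 (m+1) 0 ≤ KL 1 m 0` at every pin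

Cell `pub-balaban`, β-function sub-cell, BINDER row D4 «RemainderConst leaves for Bałaban's split» (`HOME/BINDER-OWNERS.md`; owner lineage `b2b-balaban-beta-an4`;
this file by co-owner #2 lineage `b2b-balaban-beta-d4-p2`, generation 73), β-FLOW TEAM duty (1), FREEZE (0) honoured (def-free; imports (E81b)
`…OneLagDecayFlow` and (E82a) `…YoungestTailSumCertificate`; uses `increment_anti`, `mul_invSq_add_le` (E58b), `log_concave_flow`, `sq_le_two_mul_sq` (E81b),
`strictAnti_of_memFlow` (E48a) and (E82a)'s algebra BY NAME; nothing restated).  Successor item (1) of README `HOME/b2b-balaban-beta-d4-p2/g72/e81/README.md` §6.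

HONEST FRAMING (page 1, verbatim and binding).  *"Discharging BetaPertH makes Bałaban's UV stability UNCONDITIONAL — a real constructive-QFT result; it is
NOT the continuum limit and NOT the Clay problem."*  THIS FILE DISCHARGES NOTHING OF THE KIND.  Elementary real analysis about ABSTRACT functionals on a box
]0,γ]^ℕ with displayed floors, profiles and signs, and the FIRST-ORDER renewal objects of route (N) built from them — hypotheses of a census, not facts; the
form, signs, ages and moments of Bałaban's (1.22) limit functional are NOT PRINTED ([I] p. 298; GAPS G-t4-U2-1∕-2) and NOT asserted.  Row D4 class
UNCHANGED (critical-path width 0; instance 0∕1; D4 DISCHARGE NO DATE).  HONEST DEPENDENCY: continuum YM on T⁴ ⇐ BetaPertH ∧ nine spine estimates (0/9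
proved); BetaPertH ⇐ (D1) ∧ (D4) ∧ CAP+tail; G-an2-4 gates asym, D1 and NE2/3/4.

THE POINT (census sense (α); route (N); README `g73/e82/README.md`).  (E81k) `flow_nonneg_of_sharp_static_families`: the first-order END for every box
solution modulo three STATIC families, each true along every flow tested but none proved.  Here the FIRST of them is proved for the flow in its first
instance: (S-b) at the youngest age `y = 1` for the two-age profiles `{1, k}` — by (E81d) `flow_mono2_youngest_of_growth` exactly the static inequality that
gives MONO″ for the age `1` above an old age (README `g72/e81` §3 (b): `Kk_{n+1}(1+Kk_n)(1+V_{n+1}) ≤ Kk_n(1−Ω_{n+1})`, «plausible, unproved»).  THE MECHANISM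
(numerics `g73/numerics/n1`–`n11`): against the young kernel's decay `r³ = (h_{m+1}∕h_{m+2})³` stand the young mass, the damping defect, the old lag-zero
mass `Ω ≤ q` and the Harnack load `V = θ̂_k(m+1;1)·β`, `β = x̃∕(1−x̃)` up to `≈ 1.5` for a saturated old age; three flow facts make it close: (i)
`step_split` — the old read raises the level step at `m+1` by `2q·(a_{m+1+k}∕a_{m+1})·s`, AMPLIFIED by the rise across the old window; (ii)
`load_le_half_step` + `step_le_of_window` — the old defect is at most twice the level step AT ITS OWN DEPTH, `θ̂ ≤ 2E′`, and `kE′ ≤ 1 − a_{m+1}∕a_{m+1+k}`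
(concavity of the levels); (iii) `load_le_of_window` — the old row mass obeys `4x ≤ 3(1 − a_{m+1}∕a_{m+1+k})`: a saturated old age forces a large rise across
its window, which suppresses both its defect and the loss in (i).  What is left is (E82a)'s three-variable certificate (worst ratio 0.77).  Relaxed class:
the young damping at `m+2` is dropped (`g ≤ 1`) and the one at `m+1` taken at its floor — the inequality survives (numerics: exact ratio ≤ 0.994 at deep pins
with normalised margin ≥ 0.4·E, E the level step).  NOT CLAIMED: (S-b) for three or more ages (the chain's carried ratios `β` then need the quantitative
export of (E80b)); the other families (S-a), (S-c♯); anything nonlinear; anything printed.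

WHAT IS PROVED ([folklore]; 0 `def`, 0 sorry).  §1 flow geometry: **`load_le_half_step`**, **`step_le_of_window`**, **`load_le_of_window`**, **`step_split`**;
§2 kernel bookkeeping: `kernel_entry_le`, `row_mass_le`; §3 **`flow_youngest_tail_sum_two_ages`**.
-/
noncomputable section
open Finset

namespace Summit.QuantumFields.BalabanUV.Beta.EriceRemainderEnclosureHistoryAutonomyComparisonAgeCompositionYoungestTailSumFlow

open Literature.MathematicalPhysics.QuantumFieldTheory.Balaban1983to89
open Literature.MathematicalPhysics.QuantumFieldTheory.Balaban1983to89.T4BetaStationary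
open Literature.MathematicalPhysics.QuantumFieldTheory.Balaban1983to89.T4BetaFlowWellPosed
open Summit.QuantumFields.BalabanUV.Beta.EriceRemainderEnclosureHistoryAutonomyOrder (strictAnti_of_memFlow)
open Summit.QuantumFields.BalabanUV.Beta.EriceRemainderEnclosureHistoryAutonomyComparisonAffineProfile (increment_anti mul_invSq_add_le)
open Summit.QuantumFields.BalabanUV.Beta.EriceRemainderEnclosureHistoryAutonomyComparisonAgeCompositionOneLagDecayFlow (log_concave_flow sq_le_two_mul_sq)
open Summit.QuantumFields.BalabanUV.Beta.EriceRemainderEnclosureHistoryAutonomyComparisonAgeCompositionYoungestTailSumCertificate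

variable {B : (ℕ → ℝ) → ℝ} {γ b gIR : ℝ} {L : ℕ → ℝ} {K : ℕ} {h g : ℕ → ℝ} {KL θ : ℕ → ℕ → ℕ → ℝ}

/-! ## §1 Flow geometry: level steps against window rises -/

/-- **THE LOAD ONE SCALE DEEPER IS AT MOST HALF THE LEVEL STEP**: along a box solution of an isotone memory with floor dominated by `L ≥ 0`,
`Σ_{k<K} L_k h_{t+1+k}³∕2 ≤ ((h_t∕h_{t+1})² − 1)∕2` at every depth `t` (each read `h_{t+1+k} ≤ h_t`, domination, the level step `1∕h_{t+1}² − 1∕h_t² =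
B(h(t+1+·))`).  Used at the OLD age's depth to bound the damping in its lag-one defect. [folklore] -/
theorem load_le_half_step (hL : ∀ k, 0 ≤ L k) (hb : 0 < b)
    (hlo : ∀ u, SeqBox γ u → b ≤ B u) (hdom : ∀ u, SeqBox γ u → ∑ k ∈ range K, L k * u k ≤ B u)
    (hh : SeqBox γ h) (hf : MemFlow B gIR h) (t : ℕ) :
    ∑ k ∈ range K, L k * h (t + 1 + k) ^ 3 / 2 ≤ ((h t / h (t + 1)) ^ 2 - 1) / 2 := by
  have hpos : ∀ n, 0 < h n := fun n => (hh n).1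
  have hanti := (strictAnti_of_memFlow hb hlo hh hf).antitone
  have ht := hpos t; have ht1 := hpos (t + 1)
  have e1 := hf.2 t
  have hdomB : ∑ k ∈ range K, L k * h (t + 1 + k) ≤ B (fun j => h (t + 1 + j)) := hdom _ (seqBox_shift hh (t + 1))
  have hreads : ∑ k ∈ range K, L k * h (t + 1 + k) ^ 3 / 2 ≤ h t ^ 2 * (∑ k ∈ range K, L k * h (t + 1 + k)) / 2 := by
    rw [mul_sum, sum_div]
    refine sum_le_sum fun k _ => ?_
    have hk := hpos (t + 1 + k)
    have hle : h (t + 1 + k) ≤ h t := hanti (by omega)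
    rw [div_le_div_iff_of_pos_right (by norm_num : (0:ℝ) < 2),
      show L k * h (t + 1 + k) ^ 3 = L k * (h (t + 1 + k) ^ 2 * h (t + 1 + k)) by ring,
      show h t ^ 2 * (L k * h (t + 1 + k)) = L k * (h t ^ 2 * h (t + 1 + k)) by ring]
    exact mul_le_mul_of_nonneg_left (mul_le_mul_of_nonneg_right (pow_le_pow_left₀ hk.le hle 2) hk.le) (hL k)
  have hBeq : B (fun j => h (t + 1 + j)) = 1 / h (t + 1) ^ 2 - 1 / h t ^ 2 := by linarith [e1]
  have hstep : h t ^ 2 * B (fun j => h (t + 1 + j)) = (h t / h (t + 1)) ^ 2 - 1 := by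
    rw [hBeq, div_pow]; field_simp
  have := mul_le_mul_of_nonneg_left hdomB (le_of_lt (pow_pos ht 2))
  rw [hstep] at this
  linarith

/-- **THE LEVEL STEP `k` SCALES BELOW `n` IS AT MOST `1∕k` OF THE RISE SINCE `n`**: `k·((h_{n+k}∕h_{n+k+1})² − 1) ≤ 1 − (h_{n+k}∕h_n)²` — the `k`
increments `a_{n+i+1} − a_{n+i}` (`i < k`, `a = 1∕h²`) are each at least the increment at `n+k` ((E58b) `increment_anti`), and their sum is
`a_{n+k} − a_n`; multiply by `h_{n+k}²`. [folklore] -/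
theorem step_le_of_window (hmono : ∀ u v : ℕ → ℝ, SeqBox γ u → SeqBox γ v → (∀ j, u j ≤ v j) → B u ≤ B v) (hb : 0 < b)
    (hlo : ∀ u, SeqBox γ u → b ≤ B u) (hh : SeqBox γ h) (hf : MemFlow B gIR h) (n k : ℕ) :
    (k : ℝ) * ((h (n + k) / h (n + k + 1)) ^ 2 - 1) ≤ 1 - (h (n + k) / h n) ^ 2 := by
  have hpos : ∀ n, 0 < h n := fun n => (hh n).1
  have hn := hpos n; have hnk := hpos (n + k); have hnk1 := hpos (n + k + 1)
  -- increments
  have hincr : ∀ i ∈ range k, B (fun j => h (n + k + 1 + j)) ≤ 1 / h (n + (i + 1)) ^ 2 - 1 / h (n + i) ^ 2 := by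
    intro i hi
    have hi' := mem_range.mp hi
    have e := hf.2 (n + i)
    rw [show n + (i + 1) = n + i + 1 from rfl]
    have := increment_anti hmono hb hlo hh hf (show n + i ≤ n + k by omega)
    linarith
  have hsum := sum_le_sum hincr
  rw [sum_const, card_range, nsmul_eq_mul, sum_range_sub (fun i => 1 / h (n + i) ^ 2)] at hsum
  simp only [add_zero] at hsum
  have e := hf.2 (n + k)
  have hB : B (fun j => h (n + k + 1 + j)) = 1 / h (n + k + 1) ^ 2 - 1 / h (n + k) ^ 2 := by linarith
  rw [hB] at hsum
  -- multiply by h(n+k)^2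
  have hm := mul_le_mul_of_nonneg_left hsum (le_of_lt (pow_pos hnk 2))
  have e1 : h (n + k) ^ 2 * ((k : ℝ) * (1 / h (n + k + 1) ^ 2 - 1 / h (n + k) ^ 2)) = (k : ℝ) * ((h (n + k) / h (n + k + 1)) ^ 2 - 1) := by
    field_simp
  have e2 : h (n + k) ^ 2 * (1 / h (n + k) ^ 2 - 1 / h n ^ 2) = 1 - (h (n + k) / h n) ^ 2 := by
    field_simp
  rw [e1, e2] at hm
  exact hm

/-- **AN OLD AGE'S ROW MASS IS AT MOST `3∕4` OF THE RISE ACROSS ITS WINDOW**: at a pin `n ≥ 1`, for an age `k < K` of the profile,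
`4·(k·L_kh_{n+k}³∕2) ≤ 3·(1 − (h_{n+k}∕h_n)²)` — the window's `k` increments each contain the age's own read `L_kh_{n+i+1+k} ≥ L_kh_{n+2k}`, and
`h_{n+2k} ≥ (2∕3)h_{n+k}` by the concavity of the levels ((E58b) `mul_invSq_add_le`: `a_{n+2k} ≤ 2a_{n+k}`, and `9∕4 > 2`). [folklore] -/
theorem load_le_of_window (hmono : ∀ u v : ℕ → ℝ, SeqBox γ u → SeqBox γ v → (∀ j, u j ≤ v j) → B u ≤ B v) (hL : ∀ k, 0 ≤ L k)
    (hb : 0 < b) (hlo : ∀ u, SeqBox γ u → b ≤ B u) (hdom : ∀ u, SeqBox γ u → ∑ k ∈ range K, L k * u k ≤ B u)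
    (hh : SeqBox γ h) (hf : MemFlow B gIR h) {n k : ℕ} (hn : 1 ≤ n) (hkK : k < K) :
    4 * ((k : ℝ) * (L k * h (n + k) ^ 3 / 2)) ≤ 3 * (1 - (h (n + k) / h n) ^ 2) := by
  have hpos : ∀ n, 0 < h n := fun n => (hh n).1
  have hanti := (strictAnti_of_memFlow hb hlo hh hf).antitone
  have hn0 := hpos n; have hnk := hpos (n + k); have hn2k := hpos (n + k + k)
  have hgIR : 0 < gIR := by rw [← hf.1]; exact hpos 0
  -- rise over the window: 1/h(n+k)^2 - 1/h(n)^2 ≥ k L_k h(n+2k)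
  have hincr : ∀ i ∈ range k, L k * h (n + k + k) ≤ 1 / h (n + (i + 1)) ^ 2 - 1 / h (n + i) ^ 2 := by
    intro i hi
    have hi' := mem_range.mp hi
    have e := hf.2 (n + i)
    rw [show n + (i + 1) = n + i + 1 from rfl]
    have hdomB := hdom _ (seqBox_shift hh (n + i + 1))
    have hsingle : L k * h (n + i + 1 + k) ≤ ∑ k' ∈ range K, L k' * h (n + i + 1 + k') :=
      single_le_sum (f := fun k' => L k' * h (n + i + 1 + k')) (fun k' _ => mul_nonneg (hL k') (hpos _).le) (mem_range.mpr hkK)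
    have hle : h (n + k + k) ≤ h (n + i + 1 + k) := hanti (by omega)
    have := mul_le_mul_of_nonneg_left hle (hL k)
    linarith
  have hsum := sum_le_sum hincr
  rw [sum_const, card_range, nsmul_eq_mul, sum_range_sub (fun i => 1 / h (n + i) ^ 2)] at hsum
  simp only [add_zero] at hsum
  -- h(n+2k) ≥ (2/3) h(n+k): from (n+k) a_{n+2k} ≤ (n+2k) a_{n+k} ≤ 2 (n+k) a_{n+k}
  have hconc := mul_invSq_add_le hmono hb hlo hgIR hh hf (n + k) k
  have hnkr : (1 : ℝ) ≤ (n + k : ℕ) := by exact_mod_cast (show 1 ≤ n + k by omega)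
  have hsq : h (n + k) ^ 2 ≤ 2 * h (n + k + k) ^ 2 := by
    have h1 : ((n + k : ℕ) : ℝ) * (1 / h (n + k + k) ^ 2) ≤ 2 * ((n + k : ℕ) : ℝ) * (1 / h (n + k) ^ 2) := by
      refine hconc.trans ?_
      have : ((n + k : ℕ) : ℝ) + k ≤ 2 * ((n + k : ℕ) : ℝ) := by push_cast; linarith [(Nat.cast_nonneg n : (0:ℝ) ≤ n)]
      exact mul_le_mul_of_nonneg_right this (by positivity)
    have h2 : 1 / h (n + k + k) ^ 2 ≤ 2 * (1 / h (n + k) ^ 2) := by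
      have := mul_le_mul_of_nonneg_left h1 (show (0:ℝ) ≤ 1 / (n + k : ℕ) by positivity)
      have hne : ((n + k : ℕ) : ℝ) ≠ 0 := by positivity
      calc 1 / h (n + k + k) ^ 2 = 1 / (n + k : ℕ) * (((n + k : ℕ) : ℝ) * (1 / h (n + k + k) ^ 2)) := by field_simp
        _ ≤ 1 / (n + k : ℕ) * (2 * ((n + k : ℕ) : ℝ) * (1 / h (n + k) ^ 2)) := this
        _ = 2 * (1 / h (n + k) ^ 2) := by field_simp
    rw [show 2 * (1 / h (n + k) ^ 2) = 1 / (h (n + k) ^ 2 / 2) by field_simp, one_div_le_one_div (by positivity) (by positivity)] at h2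
    linarith
  have h23 : 2 * h (n + k) ≤ 3 * h (n + k + k) := by nlinarith
  -- assemble: multiply the rise by h(n+k)^2
  have hm := mul_le_mul_of_nonneg_left hsum (le_of_lt (pow_pos hnk 2))
  have e2 : h (n + k) ^ 2 * (1 / h (n + k) ^ 2 - 1 / h n ^ 2) = 1 - (h (n + k) / h n) ^ 2 := by
    field_simp
  rw [e2] at hm
  have hLk := hL k
  have : 4 * ((k : ℝ) * (L k * h (n + k) ^ 3 / 2)) ≤ 3 * (h (n + k) ^ 2 * ((k : ℝ) * (L k * h (n + k + k)))) := by
    have hk0 : (0 : ℝ) ≤ k := Nat.cast_nonneg k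
    nlinarith [mul_le_mul_of_nonneg_left h23 (mul_nonneg (mul_nonneg hk0 hLk) (le_of_lt (pow_pos hnk 2)))]
  linarith

/-- **THE LEVEL STEP SPLIT INTO THE YOUNG READ AND ONE OLD READ.**  At a pin `n`, with `r = h_n∕h_{n+1}`, the young coefficient one pin deeper
`c′ = L_1h_{n+1}³∕2` and an old age `k ≠ 1`, `k < K`, of coefficient `q = L_kh_{n+k}³∕2`:  `2c′r + 2q·(h_n∕h_{n+k})²·(h_{n+k+1}∕h_{n+k}) ≤ r² − 1` —
domination `B ≥ L_1u_1 + L_ku_k`, the young term through the log-concavity `h_{n+2}h_n ≥ h_{n+1}²` ((E81b)), the old term an identity.  Compared with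
(E81b) `level_step_ge` the old read keeps its AMPLIFICATION `a_{n+k}∕a_n` by the level rise across the old window. [folklore] -/
theorem step_split (hmono : ∀ u v : ℕ → ℝ, SeqBox γ u → SeqBox γ v → (∀ j, u j ≤ v j) → B u ≤ B v) (hL : ∀ k, 0 ≤ L k)
    (hb : 0 < b) (hlo : ∀ u, SeqBox γ u → b ≤ B u) (hdom : ∀ u, SeqBox γ u → ∑ k ∈ range K, L k * u k ≤ B u)
    (hh : SeqBox γ h) (hf : MemFlow B gIR h) {k : ℕ} (h1K : 1 < K) (hkK : k < K) (hk1 : k ≠ 1) (n : ℕ) :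
    2 * (L 1 * h (n + 1) ^ 3 / 2) * (h n / h (n + 1)) + 2 * (L k * h (n + k) ^ 3 / 2) * ((h n / h (n + k)) ^ 2 * (h (n + k + 1) / h (n + k)))
      ≤ (h n / h (n + 1)) ^ 2 - 1 := by
  have hpos : ∀ n, 0 < h n := fun n => (hh n).1
  have h0 := hpos n; have h1 := hpos (n + 1); have h2 := hpos (n + 2); have hk := hpos (n + k); have hk1' := hpos (n + k + 1)
  have e1 := hf.2 n
  have hdomB : ∑ j ∈ range K, L j * h (n + 1 + j) ≤ B (fun j => h (n + 1 + j)) := hdom _ (seqBox_shift hh (n + 1))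
  have hpair : L 1 * h (n + 1 + 1) + L k * h (n + 1 + k) ≤ ∑ j ∈ range K, L j * h (n + 1 + j) := by
    have hsub : ({1, k} : Finset ℕ) ⊆ range K := by
      intro j hj; rw [mem_insert, mem_singleton] at hj; rw [mem_range]; rcases hj with rfl | rfl <;> assumption
    have := sum_le_sum_of_subset_of_nonneg hsub (fun j _ _ => mul_nonneg (hL j) (hpos (n + 1 + j)).le)
    rwa [sum_pair hk1.symm] at this
  have hstep : h n ^ 2 * B (fun j => h (n + 1 + j)) = (h n / h (n + 1)) ^ 2 - 1 := by
    have hBeq : B (fun j => h (n + 1 + j)) = 1 / h (n + 1) ^ 2 - 1 / h n ^ 2 := by linarith [e1]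
    rw [hBeq, div_pow]; field_simp
  -- young term: log-concavity h(n+2) h(n) ≥ h(n+1)^2
  have hlc := log_concave_flow hmono hb hlo hh hf n
  have hyoung : 2 * (L 1 * h (n + 1) ^ 3 / 2) * (h n / h (n + 1)) ≤ h n ^ 2 * (L 1 * h (n + 1 + 1)) := by
    rw [show n + 1 + 1 = n + 2 by ring]
    rw [show 2 * (L 1 * h (n + 1) ^ 3 / 2) * (h n / h (n + 1)) = L 1 * (h (n + 1) ^ 2 * h n) by field_simp]
    rw [show h n ^ 2 * (L 1 * h (n + 2)) = L 1 * (h (n + 2) * h n * h n) by ring]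
    exact mul_le_mul_of_nonneg_left (by nlinarith [hlc, h0]) (hL 1)
  -- old term: identity
  have hold : 2 * (L k * h (n + k) ^ 3 / 2) * ((h n / h (n + k)) ^ 2 * (h (n + k + 1) / h (n + k))) = h n ^ 2 * (L k * h (n + 1 + k)) := by
    rw [show n + 1 + k = n + k + 1 by ring]
    field_simp
  have := mul_le_mul_of_nonneg_left (hpair.trans hdomB) (le_of_lt (pow_pos h0 2))
  rw [mul_add, hstep] at this
  linarith [hyoung, hold]

/-! ## §2 Kernel bookkeeping -/

/-- The flow's lone kernel of age `k` ((E80e)'s `KL`): every entry is non-negative and at most the undamped coefficient `L_kh_{n+k}³∕2` on the lags `< k`,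
zero beyond (dampings in `]0, 1]`). [folklore] -/
theorem kernel_entry_le (hL : ∀ k, 0 ≤ L k) (hh : SeqBox γ h) (hg : ∀ t, 0 < g t ∧ g t ≤ 1)
    (hKL : ∀ k n l, KL k n l = if 0 < k ∧ k < K ∧ l < k then L k * h (n + k) ^ 3 / 2 * ∏ t ∈ Ico (n + 1 + l) (n + k + 1), g t else 0)
    (k n l : ℕ) : 0 ≤ KL k n l ∧ KL k n l ≤ (if l < k then L k * h (n + k) ^ 3 / 2 else 0) := by
  have hc : 0 ≤ L k * h (n + k) ^ 3 / 2 := by have := (hh (n + k)).1; have := hL k; positivity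
  have hP0 : 0 < ∏ t ∈ Ico (n + 1 + l) (n + k + 1), g t := prod_pos fun t _ => (hg t).1
  have hP1 : ∏ t ∈ Ico (n + 1 + l) (n + k + 1), g t ≤ 1 := prod_le_one (fun t _ => (hg t).1.le) fun t _ => (hg t).2
  rw [hKL]
  by_cases hlk : l < k
  · rw [if_pos hlk]
    split_ifs
    · exact ⟨mul_nonneg hc hP0.le, by nlinarith⟩
    · exact ⟨le_rfl, hc⟩
  · rw [if_neg hlk, if_neg (fun h3 => hlk h3.2.2)]
    exact ⟨le_rfl, le_rfl⟩

/-- The damped row mass of age `k < K` at any pin is at most `k` times the undamped coefficient: `x̃_k(n) ≤ x_k(n) = k·L_kh_{n+k}³∕2`. [folklore] -/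
theorem row_mass_le (hL : ∀ k, 0 ≤ L k) (hh : SeqBox γ h) (hg : ∀ t, 0 < g t ∧ g t ≤ 1)
    (hKL : ∀ k n l, KL k n l = if 0 < k ∧ k < K ∧ l < k then L k * h (n + k) ^ 3 / 2 * ∏ t ∈ Ico (n + 1 + l) (n + k + 1), g t else 0)
    {k : ℕ} (hkK : k < K) (n : ℕ) : ∑ l ∈ range K, KL k n l ≤ (k : ℝ) * (L k * h (n + k) ^ 3 / 2) := by
  calc ∑ l ∈ range K, KL k n l ≤ ∑ l ∈ range K, (if l < k then L k * h (n + k) ^ 3 / 2 else 0) :=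
        sum_le_sum fun l _ => (kernel_entry_le hL hh hg hKL k n l).2
    _ = ∑ l ∈ range k, L k * h (n + k) ^ 3 / 2 := by
        rw [← sum_range_add_sum_Ico _ hkK.le, sum_congr rfl fun l hl => if_pos (mem_range.mp hl),
          sum_congr rfl fun l hl => if_neg (not_lt.mpr (mem_Ico.mp hl).1), sum_const_zero, add_zero]
    _ = (k : ℝ) * (L k * h (n + k) ^ 3 / 2) := by rw [sum_const, card_range, nsmul_eq_mul]

/-! ## §3 The youngest member of (S-b) along the flow -/

/-- **THE YOUNGEST MEMBER OF (S-b) ALONG EVERY TWO-AGE FLOW.**  `B` isotone with floor `b > 0`, dominated by a TWO-AGE profile `L ≥ 0` (ages `1` and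
`k`, `2 ≤ k < K`, `L_j = 0` otherwise); `h` a box solution; `g` ANY damping in the relaxed class `1∕(1 + Σ_j L_jh_{t+j}³∕2) ≤ g_t ≤ 1`; `KL` the lone kernels
and `θ` the persistence defects of (E80e)∕(E75a).  Then at every pin `m`, with the old age's damped row mass `x̃ = Σ_l KL k (m+1) l` and lag-zero entry
`Ω = KL k (m+1) 0`:  **`(1 + KL 1 m 0)·((1 + θ_k(m+1;1)·x̃∕(1 − x̃))∕(1 − Ω))·KL 1 (m+1) 0 ≤ KL 1 m 0`** — the inequality `(1 + M 1 m)·Hg 1 (m+1)·KL 1 (m+1) 0 ≤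
KL 1 m 0` of the family (S-b) of (E81k) `flow_nonneg_of_sharp_static_families` at the age `i = 1` (there `M 1 m = KL 1 m 0` and, for the two-age chain,
`Hg 1 (m+1) = (1 + θ_k(m+1;1)·x̃∕(1−x̃))∕(1 − Ω)`; the identification is (E82c)).  PROOF: `step_split`, `step_le_of_window`, `load_le_of_window`,
`load_le_half_step` feed (E82a) `defect_le_two_step`, `side_bounds`, `youngest_decay_abstract` (the LP certificate) and `kernel_form`. [folklore] -/
theorem flow_youngest_tail_sum_two_ages (hmono : ∀ u v : ℕ → ℝ, SeqBox γ u → SeqBox γ v → (∀ j, u j ≤ v j) → B u ≤ B v)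
    (hL : ∀ k, 0 ≤ L k) (hb : 0 < b) (hlo : ∀ u, SeqBox γ u → b ≤ B u) (hdom : ∀ u, SeqBox γ u → ∑ k ∈ range K, L k * u k ≤ B u)
    (hh : SeqBox γ h) (hf : MemFlow B gIR h)
    (hg : ∀ t, 0 < g t ∧ g t ≤ 1) (hgF : ∀ t, 1 / (1 + ∑ k ∈ range K, L k * h (t + k) ^ 3 / 2) ≤ g t)
    {k : ℕ} (hk2 : 2 ≤ k) (hkK : k < K) (hL2 : ∀ j, j < K → j ≠ 1 → j ≠ k → L j = 0)
    (hKL : ∀ k n l, KL k n l = if 0 < k ∧ k < K ∧ l < k then L k * h (n + k) ^ 3 / 2 * ∏ t ∈ Ico (n + 1 + l) (n + k + 1), g t else 0)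
    (hθ : ∀ k n l, θ k n l = 1 - (h (n + k + l) / h (n + k)) ^ 3 * ∏ t ∈ Ico (n + k + 1) (n + k + l + 1), g t) (m : ℕ) :
    (1 + KL 1 m 0) * ((1 + θ k (m + 1) 1 * ((∑ l ∈ range K, KL k (m + 1) l) / (1 - ∑ l ∈ range K, KL k (m + 1) l)))
        / (1 - KL k (m + 1) 0)) * KL 1 (m + 1) 0 ≤ KL 1 m 0 := by
  have hpos : ∀ n, 0 < h n := fun n => (hh n).1
  have hanti := (strictAnti_of_memFlow hb hlo hh hf).antitone
  have h1K : 1 < K := by omega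
  have hk1 : k ≠ 1 := by omega
  have hkr : (2 : ℝ) ≤ k := by exact_mod_cast hk2
  have hm1 := hpos (m + 1); have hm2 := hpos (m + 2); have hmk := hpos (m + 1 + k); have hmk1 := hpos (m + 1 + k + 1)
  have hc'0 : 0 ≤ L 1 * h (m + 2) ^ 3 / 2 := by have := hL 1; positivity
  have hq0 : 0 ≤ L k * h (m + 1 + k) ^ 3 / 2 := by have := hL k; positivity
  -- kernel identities
  have e0 : KL 1 m 0 = L 1 * h (m + 2) ^ 3 / 2 * (h (m + 1) / h (m + 2)) ^ 3 * g (m + 1) := by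
    rw [hKL, if_pos ⟨Nat.one_pos, h1K, Nat.one_pos⟩, show m + 1 + 0 = m + 1 by ring, Nat.Ico_succ_singleton, prod_singleton, div_pow]
    field_simp
  have e1 : KL 1 (m + 1) 0 = L 1 * h (m + 2) ^ 3 / 2 * g (m + 2) := by
    rw [hKL, if_pos ⟨Nat.one_pos, h1K, Nat.one_pos⟩, show m + 1 + 1 + 0 = m + 1 + 1 by ring, Nat.Ico_succ_singleton, prod_singleton,
      show m + 1 + 1 = m + 2 by ring]
  have eθ : θ k (m + 1) 1 = 1 - (h (m + 1 + k + 1) / h (m + 1 + k)) ^ 3 * g (m + 1 + k + 1) := by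
    rw [hθ, Nat.Ico_succ_singleton, prod_singleton]
  -- ranges
  have hr1 : 1 ≤ h (m + 1) / h (m + 2) := by rw [le_div_iff₀ hm2, one_mul]; exact hanti (by omega)
  have hr2 : (h (m + 1) / h (m + 2)) ^ 2 ≤ 2 := by
    have hsq := sq_le_two_mul_sq hmono hb hlo hh hf m
    rw [div_pow, div_le_iff₀ (by positivity)]; linarith
  have hρ0 : 0 < (h (m + 1 + k) / h (m + 1)) ^ 2 := by positivity
  have hρ1 : (h (m + 1 + k) / h (m + 1)) ^ 2 ≤ 1 := by
    rw [div_pow, div_le_one (by positivity)]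
    exact pow_le_pow_left₀ hmk.le (hanti (by omega)) 2
  have hs0 : 0 < h (m + 1 + k + 1) / h (m + 1 + k) := by positivity
  have hsE : (h (m + 1 + k + 1) / h (m + 1 + k)) ^ 2 * (1 + ((h (m + 1 + k) / h (m + 1 + k + 1)) ^ 2 - 1)) = 1 := by
    rw [div_pow, div_pow]; field_simp; ring
  -- B3, B4, B2
  have hB3 := step_le_of_window hmono hb hlo hh hf (m + 1) k
  have hE0 : 0 ≤ (h (m + 1 + k) / h (m + 1 + k + 1)) ^ 2 - 1 := by
    have : 1 ≤ h (m + 1 + k) / h (m + 1 + k + 1) := by rw [le_div_iff₀ hmk1, one_mul]; exact hanti (by omega)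
    nlinarith
  have hB4 := load_le_of_window hmono hL hb hlo hdom hh hf (show 1 ≤ m + 1 by omega) hkK
  have hB2 := load_le_half_step hL hb hlo hdom hh hf (m + 1 + k)
  have hF'0 : 0 ≤ ∑ j ∈ range K, L j * h (m + 1 + k + 1 + j) ^ 3 / 2 :=
    sum_nonneg fun j _ => by have := hL j; have := hpos (m + 1 + k + 1 + j); positivity
  -- defect
  have hθle : θ k (m + 1) 1 ≤ 2 * ((h (m + 1 + k) / h (m + 1 + k + 1)) ^ 2 - 1) := by
    rw [eθ]; exact defect_le_two_step hs0 hsE hF'0 (hgF (m + 1 + k + 1)) hB2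
  have hθ0 : 0 ≤ θ k (m + 1) 1 := by
    rw [eθ]
    have h3 : (h (m + 1 + k + 1) / h (m + 1 + k)) ^ 3 ≤ 1 :=
      pow_le_one₀ hs0.le (by rw [div_le_one hmk]; exact hanti (by omega))
    have := (hg (m + 1 + k + 1)).2
    have := (hg (m + 1 + k + 1)).1
    nlinarith [pow_nonneg hs0.le 3]
  -- masses
  have hxt0 : 0 ≤ ∑ l ∈ range K, KL k (m + 1) l := sum_nonneg fun l _ => (kernel_entry_le hL hh hg hKL k (m + 1) l).1
  have hxtx := row_mass_le hL hh hg hKL hkK (m + 1)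
  have hΩ0 : 0 ≤ KL k (m + 1) 0 := (kernel_entry_le hL hh hg hKL k (m + 1) 0).1
  have hΩq : KL k (m + 1) 0 ≤ L k * h (m + 1 + k) ^ 3 / 2 := by
    have := (kernel_entry_le hL hh hg hKL k (m + 1) 0).2
    rwa [if_pos (by omega : 0 < k)] at this
  -- split level step
  have hsp := step_split hmono hL hb hlo hdom hh hf h1K hkK hk1 (m + 1)
  have hinv : (h (m + 1) / h (m + 1 + k)) ^ 2 = 1 / (h (m + 1 + k) / h (m + 1)) ^ 2 := by field_simp
  rw [hinv, show m + 1 + 1 = m + 2 by ring] at hsp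
  -- side bounds
  obtain ⟨hVb, hstep, h8q, hq1, hxt1⟩ := side_bounds hkr hq0 hρ0 hE0 hB3 hB4 hθ0 hθle hxt0 hxtx (ratio_ge_of_step hs0 hsE) hsp
  have hT := youngest_decay_abstract hr1 hr2 hρ0 hρ1 hc'0 hq0 hVb h8q hstep
  -- damping at m+1 from the two-age load
  have hF1 : ∑ j ∈ range K, L j * h (m + 1 + j) ^ 3 / 2 = L 1 * h (m + 2) ^ 3 / 2 + L k * h (m + 1 + k) ^ 3 / 2 := by
    have hsub : ({1, k} : Finset ℕ) ⊆ range K := by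
      intro j hj; rw [mem_insert, mem_singleton] at hj; rw [mem_range]; rcases hj with rfl | rfl <;> assumption
    rw [← sum_subset hsub (fun j hj hj' => by
      rw [mem_insert, mem_singleton, not_or] at hj'
      rw [hL2 j (mem_range.mp hj) hj'.1 hj'.2]; ring), sum_pair hk1.symm, show m + 1 + 1 = m + 2 by ring]
  have hGF : 1 / (1 + L 1 * h (m + 2) ^ 3 / 2 + L k * h (m + 1 + k) ^ 3 / 2) ≤ g (m + 1) := by
    have := hgF (m + 1); rwa [hF1, ← add_assoc] at this
  have hV0 : 0 ≤ θ k (m + 1) 1 * ((∑ l ∈ range K, KL k (m + 1) l) / (1 - ∑ l ∈ range K, KL k (m + 1) l)) :=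
    mul_nonneg hθ0 (div_nonneg hxt0 (by linarith))
  have hkey := kernel_form hc'0 hr1 hGF (hg (m + 2)).2 hΩ0 hΩq hq1 hV0 hT
  rw [e0, e1]
  exact hkey

end Summit.QuantumFields.BalabanUV.Beta.EriceRemainderEnclosureHistoryAutonomyComparisonAgeCompositionYoungestTailSumFlow

end
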